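import Summits.Parity.GeneralizedHardyLittlewood.Theorems.PrimeLevelFamEdgeMomentsBeyondDiagonalDiagBoseB0Kernel
import Summits.Parity.GeneralizedHardyLittlewood.Theorems.PrimeLevelFamEdgeMomentsBeyondDiagonalDiagBoseDecay
import HarnessLib

/-!
# Route `PrimeLevelFamEdge`, crux K_A `MomentsBeyondDiagonal` (stmt-Parity-20007), line «petersson_layers» v4, stub `stub_diag`:
# **integrability and linearity tools for the one-dimensional Bose moments `∫₀^∞ (log u)^a (e^{u+y/u} − 1)⁻¹ du` (census R2)**

Exported versions of the integrability facts used inside `…DiagBoseB0Leading.bose_coeff_a0_leading` (p818171), for the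
next R2 steps (integration by parts in the inner variable of the mixed coefficients `c_ab` produces exactly such
one-dimensional moments with polynomial weights in `log u`):

* `bose0_kernel_le_const_mul_exp_neg_half` — `(e^{u+y/u}−1)⁻¹ ≤ C_y·e^{−u/2}` on `(0,∞)` (`y > 0`);
* `integrableOn_log_pow_mul_bose0` — **`u ↦ (log u)^a (e^{u+y/u}−1)⁻¹` is integrable on `(0,∞)`** for `y > 0`;
* `integral_sum_log_pow_mul_bose0` — linearity: `∫ (Σ_k c_k (log u)^k)·K = Σ_k c_k ∫ (log u)^k·K`.

Def-free; theorems only. Helper `--supports stmt-Parity-20007`; closes nothing; K_A, K_B and the Parity summit are NOT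
proved; nothing about Landau–Siegel zeros.

## References
* E. Kowalski, P. Michel, J. VanderKam, J. reine angew. Math. 526 (2000), (22) p. 12. [cite: KowalskiMichelVanderKam2000, (22) — derivation (the diagonal cut-off weight)]
-/

noncomputable section

open Real Set MeasureTheory Finset

namespace Summit.Parity.GeneralizedHardyLittlewood.Theorems.MomentsBeyondDiagonal.DiagLines

open Summit.Parity.GeneralizedHardyLittlewood.Theorems.BeyondDiagonalBeatsQuarter.Corner
  (scriptW_integrand_le_const continuousOn_scriptW_integrand scriptW_integrand_nonneg)

/-- **A global exponential domination of the kernel**: for `y > 0` and every `u > 0`,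
`(e^{u+y/u} − 1)⁻¹ ≤ ((e^{2√y} − 1)⁻¹·e^{1/2} + 2)·e^{−u/2}`. [folklore] -/
theorem bose0_kernel_le_const_mul_exp_neg_half {y u : ℝ} (hy : 0 < y) (hu : 0 < u) :
    (Real.exp (u + y / u) - 1)⁻¹ ≤
      ((Real.exp (2 * Real.sqrt y) - 1)⁻¹ * Real.exp (1 / 2) + 2) * Real.exp (-(u / 2)) := by
  have hE0 : 0 < (Real.exp (2 * Real.sqrt y) - 1)⁻¹ :=
    inv_pos.2 (sub_pos.2 (Real.one_lt_exp_iff.2 (by positivity)))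
  have h1 : (Real.exp (u + y / u) - 1)⁻¹ ≤ (Real.exp (2 * Real.sqrt y) - 1)⁻¹ := scriptW_integrand_le_const hy hu
  rcases le_or_gt u 1 with hu1 | hu1
  · have he : 1 ≤ Real.exp (1 / 2) * Real.exp (-(u / 2)) := by
      rw [← Real.exp_add]; exact Real.one_le_exp (by linarith)
    calc (Real.exp (u + y / u) - 1)⁻¹ ≤ (Real.exp (2 * Real.sqrt y) - 1)⁻¹ * 1 := by rw [mul_one]; exact h1
      _ ≤ (Real.exp (2 * Real.sqrt y) - 1)⁻¹ * (Real.exp (1 / 2) * Real.exp (-(u / 2))) :=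
          mul_le_mul_of_nonneg_left he hE0.le
      _ ≤ _ := by nlinarith [Real.exp_pos (-(u / 2))]
  · have h2 : (Real.exp (u + y / u) - 1)⁻¹ ≤ 2 * Real.exp (-u) := bose0_kernel_le_two_exp_neg hu1.le hy.le
    have h3 : Real.exp (-u) ≤ Real.exp (-(u / 2)) := Real.exp_le_exp.2 (by linarith)
    calc (Real.exp (u + y / u) - 1)⁻¹ ≤ 2 * Real.exp (-(u / 2)) := h2.trans (by linarith)
      _ ≤ _ := by
          apply mul_le_mul_of_nonneg_right _ (Real.exp_pos _).le
          nlinarith [Real.exp_pos (1 / 2)]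

/-- **`u ↦ (log u)^a (e^{u+y/u} − 1)⁻¹` is integrable on `(0, ∞)`** for `y > 0` (dominated by `C_y e^{−u/2}|log u|^a`,
`…DiagBoseDecay.integrableOn_exp_neg_half_mul_abs_logPow`). [folklore] -/
theorem integrableOn_log_pow_mul_bose0 {y : ℝ} (hy : 0 < y) (a : ℕ) :
    IntegrableOn (fun u : ℝ ↦ Real.log u ^ a * (Real.exp (u + y / u) - 1)⁻¹) (Ioi 0) := by
  set C₁ : ℝ := (Real.exp (2 * Real.sqrt y) - 1)⁻¹ * Real.exp (1 / 2) + 2 with hC₁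
  have hMint := integrableOn_exp_neg_half_mul_abs_logPow a
  have hKcont : ContinuousOn (fun u : ℝ ↦ (Real.exp (u + y / u) - 1)⁻¹) (Ioi 0) := continuousOn_scriptW_integrand hy.le
  have hlogcont : ContinuousOn (fun u : ℝ ↦ Real.log u ^ a) (Ioi 0) :=
    (continuousOn_log.mono fun u hu ↦ ne_of_gt hu).pow a
  refine Integrable.mono' (hMint.const_mul C₁) ((hlogcont.mul hKcont).aestronglyMeasurable measurableSet_Ioi)
    (ae_restrict_of_forall_mem measurableSet_Ioi fun u hu ↦ ?_)
  have hu : 0 < u := hu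
  rw [Real.norm_eq_abs, abs_mul, abs_of_nonneg (scriptW_integrand_nonneg hy.le hu), abs_pow]
  calc |Real.log u| ^ a * (Real.exp (u + y / u) - 1)⁻¹ ≤ |Real.log u| ^ a * (C₁ * Real.exp (-(u / 2))) :=
        mul_le_mul_of_nonneg_left (bose0_kernel_le_const_mul_exp_neg_half hy hu) (by positivity)
    _ = C₁ * (Real.exp (-(u / 2)) * |Real.log u| ^ a) := by ring

/-- **Linearity of the Bose moments in a polynomial log-weight**: for `y > 0`, coefficients `c` and a range `n`,
`∫₀^∞ (Σ_{k<n} c_k (log u)^k)(e^{u+y/u}−1)⁻¹ du = Σ_{k<n} c_k ∫₀^∞ (log u)^k (e^{u+y/u}−1)⁻¹ du`. [folklore] -/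
theorem integral_sum_log_pow_mul_bose0 {y : ℝ} (hy : 0 < y) (c : ℕ → ℝ) (n : ℕ) :
    ∫ u in Ioi (0 : ℝ), (∑ k ∈ range n, c k * Real.log u ^ k) * (Real.exp (u + y / u) - 1)⁻¹ =
      ∑ k ∈ range n, c k * ∫ u in Ioi (0 : ℝ), Real.log u ^ k * (Real.exp (u + y / u) - 1)⁻¹ := by
  have h1 : ∀ u : ℝ, (∑ k ∈ range n, c k * Real.log u ^ k) * (Real.exp (u + y / u) - 1)⁻¹ =
      ∑ k ∈ range n, c k * (Real.log u ^ k * (Real.exp (u + y / u) - 1)⁻¹) := by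
    intro u
    rw [Finset.sum_mul]
    exact Finset.sum_congr rfl fun k _ ↦ by ring
  simp_rw [h1]
  rw [integral_finsetSum _ fun k _ ↦ (integrableOn_log_pow_mul_bose0 hy k).const_mul (c k)]
  exact Finset.sum_congr rfl fun k _ ↦ integral_const_mul _ _

end Summit.Parity.GeneralizedHardyLittlewood.Theorems.MomentsBeyondDiagonal.DiagLines

end
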